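import Mathlib
import HarnessLib

/-!
# Tools for the `Γ`-lift from `p`-adic cyclicity: the polynomial action `F·x = F(σ)x` of `ℤ[X]` on an
# abelian group through an endomorphism `σ`, and cancellation of `p` in a subgroup without `p`-torsion
# (K4 `SignedControlAtTwo`, stmt-BirchSwinnertonDyer-20309, line `eulerchar`; part 1 of «INJ⁺@2 ⟸ CYC⁺@2»)

Route `ThetaPartnerAtTwo` (TP2; crux shared with `ResidualThetaTransportAtTwo`), crux K4, lead seat
`prover-bsd-wall-tp2-p3` (g2). PURE ALGEBRA (Mathlib's `Polynomial.aeval` into `Module.End ℤ B`):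
`(FG)·x = F·(G·x)`, `(C c)·x = c•x`, `(X−1)·x = σx − x`, `X^n·x = σ^n x`, on a `σ`-fixed vector `F`
acts by `F(1)`, a `σ`-stable subgroup is stable under every `F·`; and `p^k • x = 0 ⇒ x = 0`,
`p • x = p • y ⇒ x = y` in a subgroup without `p`-torsion. Consumer: the sequel
`…SignedControlAtTwoCyclicLift` (the lift lemma) and `…PlusLiftOfCyclic` (INJ⁺@2 ⟸ CYC⁺@2).

HONEST FRAMING: THEOREMS ONLY (no definition, no named fact, no `sorry`), route-independent; nothing
about any curve is asserted; closes no item; BSD is not proved by any of this.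

References: [Kobayashi2003] S. Kobayashi, Invent. Math. 152 (2003) §8.4 (the `ℤ_p[Gal]`-module
structure of `E^±`); [BDKim2013] B. D. Kim, J. Aust. Math. Soc. 95 (2013), proof of Cor. 3.15;
[AtiyahMacdonald1969] Ch. 2 (modules over a polynomial ring through an endomorphism).
-/

set_option autoImplicit false
-- the Theorems namespace of this sub repeats the summit name by design (D-0017 nested layout)
set_option linter.dupNamespace false

noncomputable section

open scoped Classical
open Polynomial

namespace Summit.BirchSwinnertonDyer.BirchSwinnertonDyer.Theorems.SignedEC.CyclicLift

variable {B : Type*} [AddCommGroup B] (σ : Module.End ℤ B)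

/-! ## §1 The polynomial action `F·x = (aeval σ F) x` -/

/-- `(F G)·x = F·(G·x)`. [folklore] -/
theorem aeval_mul_apply (F G : ℤ[X]) (x : B) : aeval σ (F * G) x = aeval σ F (aeval σ G x) := by
  rw [map_mul, Module.End.mul_apply]

/-- `F·(G·x) = G·(F·x)`. [folklore] -/
theorem aeval_comm_apply (F G : ℤ[X]) (x : B) : aeval σ F (aeval σ G x) = aeval σ G (aeval σ F x) := by
  rw [← aeval_mul_apply, mul_comm, aeval_mul_apply]

/-- `(C c)·x = c • x`. [folklore] -/
theorem aeval_C_apply (c : ℤ) (x : B) : aeval σ (C c) x = c • x := by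
  rw [aeval_C, Module.algebraMap_end_apply]

/-- `(C c * F)·x = c • F·x`. [folklore] -/
theorem aeval_C_mul_apply (c : ℤ) (F : ℤ[X]) (x : B) : aeval σ (C c * F) x = c • aeval σ F x := by
  rw [aeval_mul_apply, aeval_C_apply]

/-- `(X^n)·x = σ^n x`. [folklore] -/
theorem aeval_X_pow_apply (n : ℕ) (x : B) : aeval σ ((X : ℤ[X]) ^ n) x = (σ ^ n) x := by
  rw [map_pow, aeval_X]

/-- `(X − 1)·x = σ x − x`. [folklore] -/
theorem aeval_X_sub_one_apply (x : B) : aeval σ (X - C 1 : ℤ[X]) x = σ x - x := by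
  rw [map_sub, LinearMap.sub_apply, aeval_X, aeval_C_apply, one_smul]

/-- `((X − 1) F)·x = σ (F·x) − F·x`. [folklore] -/
theorem aeval_X_sub_one_mul_apply (F : ℤ[X]) (x : B) :
    aeval σ ((X - C 1) * F) x = σ (aeval σ F x) - aeval σ F x := by
  rw [aeval_mul_apply, aeval_X_sub_one_apply]

/-- On a `σ`-fixed vector `F` acts by the scalar `F(1)`. [folklore] -/
theorem aeval_apply_of_fixed {a : B} (ha : σ a = a) (F : ℤ[X]) : aeval σ F a = F.eval 1 • a := by
  induction F using Polynomial.induction_on' with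
  | add F G hF hG => rw [map_add, LinearMap.add_apply, hF, hG, eval_add, add_smul]
  | monomial n c =>
    rw [← C_mul_X_pow_eq_monomial, aeval_C_mul_apply, aeval_X_pow_apply, eval_mul, eval_C, eval_pow,
      eval_X, one_pow, mul_one]
    congr 1
    induction n with
    | zero => rw [pow_zero, Module.End.one_apply]
    | succ n ih => rw [pow_succ, Module.End.mul_apply, ha, ih]

/-- `F·(n • x) = n • F·x`. [folklore] -/
theorem aeval_apply_nsmul (F : ℤ[X]) (n : ℕ) (x : B) : aeval σ F (n • x) = n • aeval σ F x :=
  map_nsmul _ _ _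

/-- `F·(m • x) = m • F·x` (`m : ℤ`). [folklore] -/
theorem aeval_apply_zsmul (F : ℤ[X]) (m : ℤ) (x : B) : aeval σ F (m • x) = m • aeval σ F x :=
  map_zsmul _ _ _

/-- A `σ`-stable subgroup is stable under every `F·`. [folklore] -/
theorem aeval_apply_mem {A : AddSubgroup B} (hA : ∀ x ∈ A, σ x ∈ A) (F : ℤ[X]) {x : B} (hx : x ∈ A) :
    aeval σ F x ∈ A := by
  induction F using Polynomial.induction_on' with
  | add F G hF hG => rw [map_add, LinearMap.add_apply]; exact A.add_mem hF hG
  | monomial n c =>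
    rw [← C_mul_X_pow_eq_monomial, aeval_C_mul_apply, aeval_X_pow_apply]
    refine A.zsmul_mem ?_ c
    induction n with
    | zero => rwa [pow_zero, Module.End.one_apply]
    | succ n ih => rw [pow_succ', Module.End.mul_apply]; exact hA _ ih

/-! ## §2 No `p`-torsion: cancelling `p` and `p^k` -/

/-- Cancelling `p^k` in a subgroup without `p`-torsion. [folklore] -/
theorem eq_zero_of_pow_nsmul_eq_zero {A : AddSubgroup B} {p : ℕ} (hnt : ∀ x ∈ A, p • x = 0 → x = 0) (k : ℕ)
    {x : B} (hx : x ∈ A) (h : p ^ k • x = 0) : x = 0 := by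
  induction k generalizing x with
  | zero => rwa [pow_zero, one_smul] at h
  | succ k ih =>
    rw [pow_succ, mul_smul] at h
    exact hnt _ hx (ih (A.nsmul_mem hx _) h)

/-- `p • x = p • y ⇒ x = y` in a subgroup without `p`-torsion. [folklore] -/
theorem nsmul_cancel {A : AddSubgroup B} {p : ℕ} (hnt : ∀ x ∈ A, p • x = 0 → x = 0) {x y : B} (hx : x ∈ A)
    (hy : y ∈ A) (h : p • x = p • y) : x = y :=
  sub_eq_zero.mp (hnt _ (A.sub_mem hx hy) (by rw [smul_sub, h, sub_self]))

/-- `p^k • x = p^k • y ⇒ x = y` in a subgroup without `p`-torsion. [folklore] -/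
theorem pow_nsmul_cancel {A : AddSubgroup B} {p : ℕ} (hnt : ∀ x ∈ A, p • x = 0 → x = 0) (k : ℕ) {x y : B}
    (hx : x ∈ A) (hy : y ∈ A) (h : p ^ k • x = p ^ k • y) : x = y :=
  sub_eq_zero.mp (eq_zero_of_pow_nsmul_eq_zero hnt k (A.sub_mem hx hy) (by rw [smul_sub, h, sub_self]))

end Summit.BirchSwinnertonDyer.BirchSwinnertonDyer.Theorems.SignedEC.CyclicLift

end
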